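import Literature.MathematicalPhysics.QuantumFieldTheory.Balaban1983to89.Node00.BackgroundCurrentCompare

/-!
# `Balaban1983to89.B11Thm1LevelZero` — [Balaban1985Variational] Theorem 1 p. 279 AT NODE 00's OBJECTS, LEVEL `k = 0`: the trivial level of the
# variational problem (5)–(6) («`U_0(V) = V`») in the currency of Stage ₈a (`Node00/BackgroundActionOfRecord`, `BackgroundCurrentShape∕Compare`) —
# the GAPS rows G₈a-1 (solvability), G₈a-2 (one residual orbit), G₈a-3 (the minimiser lies in [B11] (2)'s space ∕ [I] (1.2)'s full space) HOLD
# OUTRIGHT at `k = 0`, via one genuine lattice estimate: the scale-0 divergence clause of (2) from the plaquette clause («`|D^{η*}_U ∂U| ≤ 2(d−1)η⁻¹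
# max|U(∂p) − 1|`»)

T. Bałaban, *The variational problem and background fields in renormalization group method for lattice gauge theories*, Commun. Math. Phys. **102**
(1985) 277–309 [Balaban1985Variational] (B11): Theorem 1 p. 279, the spaces (2), (6), (8) p. 278; T. Bałaban, *Renormalization group approach to lattice
gauge field theories. I*, Commun. Math. Phys. **109** (1987) 249–301 [Balaban1987RG1] («[I]»): (0.21) p. 256, (1.1)–(1.2) p. 260; [Balaban1985RegularSpaces]
(1.1)–(1.2), (1.7), (1.9) pp. 76–77 for the covariant divergence.  Seat `pub-ymgap-dag-n07-a` (gen 2; YM-PLAN Track A, HUMAN RULING D-0062, KNIT-BY-NAME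
seat of node N07 [B11]); companion of `B11LeafUnpinnedRecord` (census) and `B11Thm1CarrierT` (the Theorem-1 carrier read at ₈a's objects).
THEOREMS ONLY (0 `def`, 0 `sorry`, standard axioms).

WHY THIS FILE.  Theorem 1 is proved in print by induction on `k` (p. 279: *«Theorem 1 will be proved by induction with respect to k … The first step of
the proof, for k = 1, will be covered by the proof of a general case»*); at NODE 00's objects its three clauses are the DISPLAYED rows G₈a-1∕2∕3 of ₈a
(`Node00.UkExists`, `UniqueUkOrbit`, `UkInSpaceB11`∕`UkCurrentSmall`), asserted nowhere.  At the trivial level `k = 0` (the constraint `Ū^0 = V` is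
`U = V`, [I] (0.11) `M^0 = id`) they are THEOREMS, and this file records them — a non-vacuity ∕ orientation check of ₈a's typing (the predicates compose as
print intends) and the base of the level tower, NOT a step of Bałaban's induction (which starts at `k = 1` and is 30 pages of nonlinear analysis).  The one
estimate with content is §1: the divergence clause of (2) at the TOP scale follows from the plaquette clause with the constant `2(d−1)` (each backward
covariant derivative of the plaquette field costs two plaquette deviations, by unitarity of the transports) — [Balaban1985RegularSpaces] (1.9) from (1.7) at
`j = 0` up to the constant; at scales `j ≥ 1` no such implication holds (the thresholds differ by `L^j`), which is why (2) carries both clauses.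

WHAT IS PROVED.
§1 (generic Banach algebra `𝔸`, torus of any level): `norm_covDerivT_le` (`‖(D^{η*}_{V,ν}F)(x)‖ ≤ η⁻¹(‖F(x−e_ν) − 1‖ + ‖F(x) − 1‖)` for transports in
   `{|u| ≤ 1, |u⁻¹| ≤ 1}`), **`norm_covDivT_le`** (`‖(D^{η*}_V ∂V)_μ(x)‖ ≤ η⁻¹·2(d−1)·δ` if every plaquette field is within `δ` of `1`, both orientations);
   for the cell's `U(N)`∕`SU(N)`: `norm_plaqFT_toUField_sub_one_lt` (both orientations from `PlaqSmall`), **`inUkClassB11_zero_of_plaqSmall`**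
   (`|V(∂p) − 1| < ε`, `ε > 0` ⇒ `V ∈ 𝔘_0({T}, 7ε)`, `d = 4`: `7 = 2(d−1) + 1`).
§2 (₈a at level 0): `eta_zero` (`η_0 = 1`), `isBackground_zero_iff` (`IsBackground av reg 0 V U ↔ U = V ∧ U ∈ reg`), **`ukExists_zero_iff`** (G₈a-1 at
   `k = 0`: solvable iff `V ∈ bgReg`), **`uniqueUkOrbit_zero`** (G₈a-2 at `k = 0`, outright), `Uk_zero_eq` (`U_0(V) = V` on the solvable set),
   **`ukInSpaceB11_zero`** (G₈a-3's (2)-form at `k = 0` with `ε₀ = 7ε`), `ukCurrentSmall_zero` (its (1.2)-form, `ε₀ = 14ε`, by n01-b's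
   `ukCurrentSmall_of_ukInSpaceB11`), and the summary **`thm1_objects_levelZero`**: for `0 < ε₁` and `|V(∂p) − 1| < ε₁`, the level-0 problem over
   `bgReg(B₃ε₁)` is solvable with `U_0(V) = V ∈ 𝔘_0(B₃ε₁)` and one residual orbit, `B₃ = 7`.

HONEST FRAMING: count-neutral; N07 NOT discharged (its Theorem-1 slot needs ALL levels with uniform constants — the `k ≥ 1` levels are Bałaban's theorem,
proved nowhere in the tree); nothing of the induction is claimed; no object of record is touched; one finite four-torus programme at fixed `ε`; nothing
continuum ∕ ℝ⁴ ∕ OS ∕ mass-gap ∕ Clay.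
-/

noncomputable section

namespace Literature.MathematicalPhysics.QuantumFieldTheory.Balaban1983to89.B11Thm1LevelZero

open scoped Matrix.Norms.L2Operator
open T4Continuum (T4Family)
open B7Prop1Explicit (U1 plaqWord)
open B7Prop2Explicit (unitaryUnits unitaryUnits_le_U1)
open B7Eq78Linearization (conjR conjR_sub conjR_one)
open B8Ineq132 (norm_conjR)
open B10Eq27TorusAxialLog (holT unitsField toUField unitsField_mem_unitaryUnits norm_holT_unitsField_plaqWord_sub_one holT_plaqWord_swap
  dist1_plaqHol_toUField)
open B10Eq68TorusRegularity (plaqFT covDerivT covDivT RegDivAt RegPlaqAt InSpaceA InSpace BTouches regPlaqAt_unitsField_iff)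
open B12GaugeOrbits021 (OrbitRel)
open Node00 (SU avOfRecord bgReg mem_bgReg_iff UkExists UniqueUkOrbit Uk isBackground_Uk InUkClassB11 UkInSpaceB11 UkCurrentSmall
  regAt_univ_toUField_iff_mem_bgReg)

/-! ## §1 The divergence clause of (2) at the top scale from the plaquette clause -/

section Generic

variable {P : Params} {s : ℕ} {𝔸 : Type*} [NormedRing 𝔸] [NormedAlgebra ℂ 𝔸] [NormOneClass 𝔸]

/-- **One backward covariant derivative costs two plaquette deviations**: `‖(D^{η*}_{V,ν}F)(x)‖ ≤ η⁻¹(‖F(x − e_ν) − 1‖ + ‖F(x) − 1‖)` for transports in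
`{|u| ≤ 1, |u⁻¹| ≤ 1}` (`‖R(u)X − 1‖ = ‖R(u)(X − 1)‖ = ‖X − 1‖`, `B8Ineq132.norm_conjR`), `η > 0`. [cite: Balaban1985RegularSpaces, (1.1) p.76] -/
theorem norm_covDerivT_le {η : ℝ} (hη : 0 < η) (V : GaugeField P s 𝔸ˣ) (hV : ∀ b, V b ∈ U1 𝔸) (ν : Fin P.d) (F : Site P s → 𝔸) (x : Site P s) :
    ‖covDerivT η V ν F x‖ ≤ η⁻¹ * (‖F (x.unshift ν) - 1‖ + ‖F x - 1‖) := by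
  unfold covDerivT
  rw [norm_smul, Real.norm_eq_abs, abs_of_pos (inv_pos.mpr hη)]
  refine mul_le_mul_of_nonneg_left ?_ (inv_pos.mpr hη).le
  have hu : (V ⟨x.unshift ν, ν⟩)⁻¹ ∈ U1 𝔸 := (U1 𝔸).inv_mem (hV _)
  have h1 : conjR (V ⟨x.unshift ν, ν⟩)⁻¹ (F (x.unshift ν)) - F x =
      conjR (V ⟨x.unshift ν, ν⟩)⁻¹ (F (x.unshift ν) - 1) - (F x - 1) := by
    rw [conjR_sub, conjR_one]; abel
  rw [h1]
  exact (norm_sub_le _ _).trans (by rw [norm_conjR hu])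

/-- **THE TOP-SCALE DIVERGENCE BOUND**: if every plaquette field of `V` (both orientations) is within `δ` of `1`, then
`‖(D^{η*}_V ∂V)_μ(x)‖ ≤ η⁻¹ · 2(d − 1) · δ` — `d − 1` backward derivatives (`ν ≠ μ`), each `≤ 2δη⁻¹` by `norm_covDerivT_le`.
[cite: Balaban1985RegularSpaces, (1.2) p.76, (1.7)/(1.9) p.77] -/
theorem norm_covDivT_le {η : ℝ} (hη : 0 < η) (V : GaugeField P s 𝔸ˣ) (hV : ∀ b, V b ∈ U1 𝔸) {δ : ℝ}
    (hF : ∀ (κ ν : Fin P.d) (y : Site P s), κ ≠ ν → ‖plaqFT V κ ν y - 1‖ ≤ δ) (μ : Fin P.d) (x : Site P s) :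
    ‖covDivT η V μ x‖ ≤ η⁻¹ * (2 * ((P.d - 1 : ℕ) : ℝ) * δ) := by
  have hterm : ∀ (ν : Fin P.d) (κ κ' : Fin P.d), κ ≠ κ' → ‖covDerivT η V ν (plaqFT V κ κ') x‖ ≤ η⁻¹ * (2 * δ) := by
    intro ν κ κ' hne
    refine (norm_covDerivT_le hη V hV ν _ x).trans (mul_le_mul_of_nonneg_left ?_ (inv_pos.mpr hη).le)
    have h1 := hF κ κ' (x.unshift ν) hne
    have h2 := hF κ κ' x hne
    linarith
  unfold covDivT
  have hIio : ‖∑ ν ∈ Finset.Iio μ, covDerivT η V ν (plaqFT V ν μ) x‖ ≤ (Finset.Iio μ).card • (η⁻¹ * (2 * δ)) :=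
    (norm_sum_le _ _).trans (Finset.sum_le_card_nsmul _ _ _ fun ν hν => hterm ν ν μ (Finset.mem_Iio.mp hν).ne)
  have hIoi : ‖∑ ν ∈ Finset.Ioi μ, covDerivT η V ν (plaqFT V μ ν) x‖ ≤ (Finset.Ioi μ).card • (η⁻¹ * (2 * δ)) :=
    (norm_sum_le _ _).trans (Finset.sum_le_card_nsmul _ _ _ fun ν hν => hterm ν μ ν (Finset.mem_Ioi.mp hν).ne)
  have hcard : ((Finset.Iio μ).card : ℝ) + (Finset.Ioi μ).card = ((P.d - 1 : ℕ) : ℝ) := by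
    rw [Fin.card_Iio, Fin.card_Ioi]
    have hμ := μ.isLt
    rw [← Nat.cast_add]
    congr 1
    omega
  calc ‖∑ ν ∈ Finset.Iio μ, covDerivT η V ν (plaqFT V ν μ) x - ∑ ν ∈ Finset.Ioi μ, covDerivT η V ν (plaqFT V μ ν) x‖
      ≤ (Finset.Iio μ).card • (η⁻¹ * (2 * δ)) + (Finset.Ioi μ).card • (η⁻¹ * (2 * δ)) := (norm_sub_le _ _).trans (add_le_add hIio hIoi)
    _ = η⁻¹ * (2 * ((P.d - 1 : ℕ) : ℝ) * δ) := by rw [nsmul_eq_mul, nsmul_eq_mul, ← add_mul, hcard]; ring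

end Generic

/-! ### The cell's `U(N)` ∕ `SU(N)`: both orientations from `PlaqSmall`; `V ∈ 𝔘_0({T}, 7ε)` -/

section UnitaryGroup

variable {P : Params} {s : ℕ} {N : ℕ} [NeZero N]

/-- **Both orientations of the plaquette field from `PlaqSmall`** for an `SU(N)`-valued torus configuration read in `M_N(ℂ)`: `‖V(∂p) − 1‖ < ε` for every
plaquette word `(+e_κ, +e_μ, −e_κ, −e_μ)`, `κ ≠ μ` (the reversed orientation is the inverse holonomy, whose distance to `1` is not larger for unitaries —
the bookkeeping of `B10Eq27TorusAxialLog.h13_unitsField`, region-free). [cite: Balaban1985Variational, (2) p.278 (plaquette clause); Balaban1985Averaging, (9), (19) pp.19–21] -/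
theorem norm_plaqFT_toUField_sub_one_lt (U : GaugeField P s (SU N)) {ε : ℝ} (h : PlaqSmall ε U) (κ μ : Fin P.d) (y : Site P s) (hne : κ ≠ μ) :
    ‖plaqFT (unitsField (toUField U)) κ μ y - 1‖ < ε := by
  letI : CStarAlgebra (Matrix (Fin N) (Fin N) ℂ) := B10Eq29TubeLine.cstarAlgebraMatrix N
  unfold plaqFT
  rcases lt_or_gt_of_ne hne with hlt | hgt
  · rw [norm_holT_unitsField_plaqWord_sub_one (toUField U) y hlt, dist1_plaqHol_toUField]
    exact h _
  · have hmem : holT (unitsField (toUField U)) y (plaqWord μ κ) ∈ unitaryUnits (Matrix (Fin N) (Fin N) ℂ) := by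
      rw [← B10Eq27TorusAxialLog.hol_pull_zero]
      exact B7Prop2Explicit.hol_mem_of (V := B10Eq27TorusAxialLog.pull (unitsField (toUField U)) y)
        (fun _ _ => unitsField_mem_unitaryUnits (toUField U) _) 0 _
    rw [holT_plaqWord_swap]
    refine (B7Prop1Explicit.norm_inv_sub_one_le (unitaryUnits_le_U1 hmem)).trans_lt ?_
    rw [norm_holT_unitsField_plaqWord_sub_one (toUField U) y hgt, dist1_plaqHol_toUField]
    exact h _

/-- The bond variables of an `SU(N)` configuration read in `M_N(ℂ)ˣ` lie in `{|u| ≤ 1, |u⁻¹| ≤ 1}`. [cite: Balaban1985Averaging, (19) p.21 (the U(N) model; bookkeeping)] -/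
theorem unitsField_toUField_mem_U1 (U : GaugeField P s (SU N)) (b : PBond P s) :
    unitsField (toUField U) b ∈ U1 (Matrix (Fin N) (Fin N) ℂ) := by
  letI : CStarAlgebra (Matrix (Fin N) (Fin N) ℂ) := B10Eq29TubeLine.cstarAlgebraMatrix N
  exact unitaryUnits_le_U1 (unitsField_mem_unitaryUnits (toUField U) b)

/-- **THE TOP-SCALE DIVERGENCE BOUND for `SU(N)`**: `|U(∂p) − 1| < ε` on the whole torus ⇒ `‖(D^{η*}_U ∂U)_μ(x)‖ ≤ η⁻¹·2(d−1)·ε`.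
[cite: Balaban1985RegularSpaces, (1.2) p.76, (1.7)/(1.9) p.77] -/
theorem norm_covDivT_toUField_le (U : GaugeField P s (SU N)) {ε η : ℝ} (hη : 0 < η) (h : PlaqSmall ε U) (μ : Fin P.d) (x : Site P s) :
    ‖covDivT η (unitsField (toUField U)) μ x‖ ≤ η⁻¹ * (2 * ((P.d - 1 : ℕ) : ℝ) * ε) :=
  norm_covDivT_le hη _ (unitsField_toUField_mem_U1 U) (fun κ ν y hne => (norm_plaqFT_toUField_sub_one_lt U h κ ν y hne).le) μ x

end UnitaryGroup

/-! ## §2 Stage ₈a at level `k = 0` -/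

section LevelZero

variable (F : T4Family) (N : ℕ) [NeZero N]

/-- `η_0 = L^{−0} = 1`. [cite: Balaban1985Variational, (5) p.278 («η = L^{−k}»)] -/
theorem eta_zero (K : ℕ) : (F.P K).eta 0 = 1 := by
  simp [Params.eta]

/-- **`V ∈ 𝔘_0({T}, 7ε)` from `|V(∂p) − 1| < ε`, `ε > 0`** (`d = 4`, `η_0 = 1`): the plaquette clause with `ε ≤ 7ε` (n01-b's alignment
`regAt_univ_toUField_iff_mem_bgReg`) and the divergence clause by `norm_covDivT_toUField_le` (`6ε < 7ε`). [cite: Balaban1985Variational, (2) p.278] -/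
theorem inUkClassB11_zero_of_plaqSmall (K : ℕ) {ε : ℝ} (hε : 0 < ε) {V : GaugeField (F.P K) 0 (SU N)} (h : PlaqSmall ε V) :
    InUkClassB11 F N K 0 (7 * ε) V := by
  intro j hj
  obtain rfl : j = 0 := Nat.le_zero.mp hj
  refine ⟨?_, ?_⟩
  · rw [regPlaqAt_unitsField_iff, regAt_univ_toUField_iff_mem_bgReg, mem_bgReg_iff, eta_zero]
    intro p
    have := h p
    linarith
  · intro b _
    rw [eta_zero]
    refine (norm_covDivT_toUField_le V one_pos h b.dir b.src).trans_lt ?_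
    simp only [T4Family.P_d, pow_zero, inv_one, one_pow, mul_one, one_mul]
    norm_num
    linarith

/-- **`IsBackground` AT LEVEL 0 IS «`U = V` ∧ `U` regular»**: the constraint `Ū^0 = V` is `U = V` (`Averaging.iter av 0 = id`), and the only competitor is
`V` itself. [cite: Balaban1987RG1, (0.21) p.256 and (0.11) p.253 (`k = 0`)] -/
theorem isBackground_zero_iff {P : Params} {G : Type*} [GaugeGroup G] (av : ∀ j, Averaging P j G) (reg : Set (GaugeField P 0 G))
    (V U : GaugeField P 0 G) : IsBackground av reg 0 V U ↔ U = V ∧ U ∈ reg := by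
  refine ⟨fun h => ⟨h.1, h.2.1⟩, fun ⟨hUV, hreg⟩ => ⟨hUV, hreg, fun U' _ hU'V => ?_⟩⟩
  have h1 : U' = V := hU'V
  rw [h1, ← hUV]

variable {F N}

/-- **G₈a-1 AT LEVEL 0**: the level-0 problem is solvable at `V` iff `V` is regular (`V ∈ bgReg F N K 0 ε`), the solution being `V`.
[cite: Balaban1987RG1, (1.1) p.260 (`k = 0`); Balaban1985Variational, Thm 1 (8) p.279] -/
theorem ukExists_zero_iff {K : ℕ} (ε : ℝ) (V : GaugeField (F.P K) 0 (SU N)) : UkExists F N K 0 ε V ↔ V ∈ bgReg F N K 0 ε := by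
  refine ⟨fun ⟨U₀, hU₀⟩ => ?_, fun hV => ⟨V, (isBackground_zero_iff _ _ V V).2 ⟨rfl, hV⟩⟩⟩
  obtain ⟨rfl, hreg⟩ := (isBackground_zero_iff _ _ V U₀).1 hU₀
  exact hreg

/-- **G₈a-2 AT LEVEL 0, OUTRIGHT**: any two level-0 minimisers are `V`, hence in one residual orbit. [cite: Balaban1987RG1, (1.1) p.260 (`k = 0`); Balaban1985Variational, Thm 1 p.279 (uniqueness)] -/
theorem uniqueUkOrbit_zero {K : ℕ} (ε : ℝ) (V : GaugeField (F.P K) 0 (SU N)) : UniqueUkOrbit F N K 0 ε V := by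
  intro U₀ U₀' h h'
  obtain ⟨rfl, -⟩ := (isBackground_zero_iff _ _ V U₀).1 h
  obtain ⟨rfl, -⟩ := (isBackground_zero_iff _ _ _ U₀').1 h'
  exact OrbitRel.refl 0 _

/-- **`U_0(V) = V`** on the solvable set (₈a's `Uk` at level 0). [cite: Balaban1987RG1, (0.21) p.256 (`k = 0`)] -/
theorem Uk_zero_eq {K : ℕ} {ε : ℝ} {V : GaugeField (F.P K) 0 (SU N)} (hV : V ∈ bgReg F N K 0 ε) : Uk F N K 0 ε V = V :=
  ((isBackground_zero_iff _ _ V _).1 (isBackground_Uk ((ukExists_zero_iff ε V).2 hV))).1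

/-- **G₈a-3 AT LEVEL 0, (2)-FORM**: whenever the level-0 problem over `bgReg(ε)` is solvable, `U_0(V) = V ∈ 𝔘_0({T}, 7ε)` (`ε > 0`).
[cite: Balaban1985Variational, Thm 1 (8) p.279 and (2) p.278 (`k = 0`)] -/
theorem ukInSpaceB11_zero (K : ℕ) {ε : ℝ} (hε : 0 < ε) : UkInSpaceB11 F N K 0 ε (7 * ε) := by
  intro V hV
  have hreg : V ∈ bgReg F N K 0 ε := (ukExists_zero_iff ε V).1 hV
  rw [Uk_zero_eq hreg]
  have hpl : PlaqSmall ε V := by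
    have := (mem_bgReg_iff F N K 0 ε V).1 hreg
    rwa [eta_zero, one_pow, mul_one] at this
  exact inUkClassB11_zero_of_plaqSmall F N K hε hpl

/-- **G₈a-3 AT LEVEL 0, [I] (1.2)-FORM** (`|J| < 14ε`): n01-b's `Node00.ukCurrentSmall_of_ukInSpaceB11` (constant 2) on `ukInSpaceB11_zero`.
[cite: Balaban1987RG1, (1.2) p.260 (`k = 0`)] -/
theorem ukCurrentSmall_zero (K : ℕ) {ε : ℝ} (hε : 0 < ε) : UkCurrentSmall F N K 0 ε (2 * (7 * ε)) :=
  Node00.ukCurrentSmall_of_ukInSpaceB11 F N (ukInSpaceB11_zero K hε)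

/-- **THEOREM 1 AT LEVEL 0 IN ₈a's CURRENCY** (`B₃ = 7`, `d = 4`): for `0 < ε₁` and a datum `V` with (7) `|V(∂p) − 1| < ε₁`, the level-0 problem over
`bgReg(7ε₁)` is solvable (G₈a-1), its solution of record is `V` and lies in [B11] (2)'s space `𝔘_0({T}, 7ε₁)` ((8)), and the minimisers form one residual
orbit (G₈a-2).  The trivial level only — NOT a step of Bałaban's induction. [cite: Balaban1985Variational, Thm 1 p.279 (`k = 0`)] -/
theorem thm1_objects_levelZero (K : ℕ) {ε₁ : ℝ} (hε₁ : 0 < ε₁) (V : GaugeField (F.P K) 0 (SU N)) (hV : PlaqSmall ε₁ V) :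
    UkExists F N K 0 (7 * ε₁) V ∧ Uk F N K 0 (7 * ε₁) V = V ∧ InUkClassB11 F N K 0 (7 * ε₁) V ∧ UniqueUkOrbit F N K 0 (7 * ε₁) V := by
  have h7 : InUkClassB11 F N K 0 (7 * ε₁) V := inUkClassB11_zero_of_plaqSmall F N K hε₁ hV
  have hreg : V ∈ bgReg F N K 0 (7 * ε₁) := h7.mem_bgReg
  exact ⟨(ukExists_zero_iff _ V).2 hreg, Uk_zero_eq hreg, h7, uniqueUkOrbit_zero _ V⟩

end LevelZero

end Literature.MathematicalPhysics.QuantumFieldTheory.Balaban1983to89.B11Thm1LevelZero
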